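import Literature.MathematicalPhysics.QuantumFieldTheory.Balaban1983to89.B8LeafModelZd3
import Literature.MathematicalPhysics.QuantumFieldTheory.Balaban1983to89.B8Ineq165AllLevels

/-!
# `Balaban1983to89.B8LeafModelZd3Ineq165` — [Balaban1985RegularSpaces] p. 87 **(1.65)** AT THE N05 PROTOTYPE `zdGF3`: the member's
# closeness fields `avgClose` / `avgClose166` (both typed in the tree's (1.66) currency «on Ω_j^{(j)}», boxes in `Ω_j`, ALL `j ≤ k`)
# DERIVED, with `α₁ ↦ 11d²α₀ + α₁`, from (1.33), (1.34) and print's GENUINE (1.35) ON THE LAYERS `Λ_j = Λs k j`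

statement-level skeleton of published theorems with citation tags; proofs where landed; nothing here is a claim about the
Yang–Mills mass gap

PDF held: `paper:balaban1985-cmp99-regular-spaces-gauge-fixing` (journal page = PDF page + 74); p. 77 ((1.3)–(1.6), bond convention), p. 82
((1.33)–(1.35)), p. 87 ((1.65)–(1.66)), p. 88 (Theorem 4, «Of course this theorem implies Theorem 2»).

WHY THIS FILE (cell `pub-ymgap`, seat `pub-ymgap-dag-n05-a` g6, KNIT seat of DAG node N05 = [B8]; count-neutral).  The discharge referee
(dag-ref-A g8, VERDICTS g8-5/g8-6, WATCH-(1.35)/(1.66)) located that the prototype member `B8LeafModelZd3.zdGF3` types its field `avgClose`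
— documented in `B8.GFData` as (1.35) «on Λ_j» — in the (1.66) currency (closeness on EVERY level-`j` bond whose box lies in `Ω_j`), so
that `B8LeafModelZd3Thm2.thm2Printed_zd3_univ` is «Theorem 2 with (1.66) in place of (1.35)» and the printed step (1.65) does no work there.
Two rulings are open (dag-lead WORDS-95): (a) book t2 in that form — then the (1.35) ⇒ (1.66) descent is the t2-CONSUMER's; (b) re-type the
member's `avgClose` to the layer form — then the descent is N05's.  This file is the ruling-NEUTRAL adapter both need: AT THE MEMBER, from
(1.33) `InA α₀ U₀`, (1.34) `InAAx α₀ U₀ P` and the LAYER form of (1.35) at `α₁` (closeness only on the level-`j` bonds touching `Λs k j`,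
boxes in `Ω_j`), the member's `avgClose (11d²α₀ + α₁) U₀ P` follows (`B8Ineq165AllLevels.norm_avg_sub_le_allLevels_of135`), and on the
`Ω₀ = ℤᵈ` sub-family (the index of NODE 00's [B8] pin, `IdxB8`) also `avgClose166 (11d²α₀ + α₁) U₀ P` (its level-`0` clause by
`norm_pert_sub_one_le_univ_of135`) — PROVIDED the member's region sequence carries print's tower decomposition (1.6) AT EVERY LEVEL
(`h16`; the index `ZdIdx` carries only its level-`0` instance `hpart`; located design point №11 for the pin, with a counter-member in the
module docstring of `B8Ineq165AllLevels`).

WHAT IS PROVED (kernel, 0 sorry, theorems only): **`avgClose_zdGF3_of135`**, **`avgClose166_zdGF3_of135_univ`**, and the packaging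
`avgClose_and_avgClose166_zdGF3_of135_univ` (both at once on the univ sub-family, the shape Theorem 4's hypothesis `h166` of
`B8LeafModelZd3Thm2` consumes).

HONEST SCOPE.  By-name instantiation of `B8Ineq165AllLevels` at the member's fields (unfolded definitionally); windows of (1.65) as there
(`C₀α₀ ≤ 1/3`, `2α₀ ≤ c₂′`, `11d²α₀ + α₁ ≤ 1/6`); `h16` and the layer-(1.35) are HYPOTHESES (no member field is changed — that is ruling
(b), definition lane).  Count-neutral; N05 NOT discharged; nothing continuum / ℝ⁴ / OS / mass-gap / Clay.  Unit `pub-ymgap-dag-n05-a` (g6),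
2026-08-26.
-/

noncomputable section

namespace Literature.MathematicalPhysics.QuantumFieldTheory.Balaban1983to89.B8LeafModelZd3Ineq165

open B7Prop1Explicit B7Prop2Explicit B7Prop1Local
open B7Prop2Explicit (C0 c2')
open B8Ineq132 (InAk Under BondTouches)
open B8Eq119TwistedAxial (InAx)
open B8Lemma1NonAbelian (mulCfg)
open B8Eq140Level (SideTouches)
open B8Ineq130 (tlo thi)
open B8LeafModelZd (ZdIdx)
open B8LeafModelZd3 (zdGF3)
open B8Ineq165AllLevels (norm_avg_sub_le_allLevels_of135 norm_pert_sub_one_le_univ_of135)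

-- `Site` alone could resolve to the torus sites of `Setup.lean`; re-export the `ℤ^d` sites of `B7Prop1Explicit`.
export B7Prop1Explicit (Site)

variable {d : ℕ}

section Member

variable {𝔸 : Type} [CStarAlgebra 𝔸] [Nontrivial 𝔸]

/-- **(1.65) AT THE MEMBER: `zdGF3.avgClose (11d²α₀ + α₁)` FROM (1.33), (1.34) AND (1.35) ON THE LAYERS** (p. 87 «Thus the conditions
(1.33)–(1.35) imply |Ũ′ʲ − 1| < 11d²α₀ + α₁ on Ω_j^{(j)}»): for a member `i : ZdIdx d L` whose region sequence carries the tower decomposition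
(1.6) at every level (`h16`), `d ≥ 1`, `L ≥ 2`, the windows of (1.65), a background `U₀` with (1.33) `InA α₀ U₀` and a datum `P` with (1.34)
`InAAx α₀ U₀ P`, closeness `≤ α₁` of the level-`j` averages on the level-`j` bonds TOUCHING `Λs k j` with box in `Ω_j` (print's (1.35), p. 77
convention) implies the member's field `avgClose (11d²α₀ + α₁) U₀ P` (closeness on every level-`j` bond with box in `Ω_j`, all `j ≤ k`).
[cite: Balaban1985RegularSpaces, (1.65)–(1.66) p.87, (1.33)–(1.35) p.82, (1.3)–(1.6) p.77] -/
theorem avgClose_zdGF3_of135 (hd : 1 ≤ d) {L : ℕ} (hL : 2 ≤ L) {β : ℝ} {len : Site d → ℝ} (i : ZdIdx d L)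
    (h16 : ∀ ℓ, ℓ ≤ i.k → ∀ w : Site d, (∀ x, InBox (tlo L w ℓ) (thi L w ℓ) x → x ∈ i.Ω ℓ) →
      ∃ j, ℓ ≤ j ∧ j ≤ i.k ∧ ∃ y ∈ i.Λs i.k j, Under L (j - ℓ) y w)
    {α₀ α₁ : ℝ} (hα₀ : 0 < α₀) (hα3 : C0 d * α₀ ≤ 1 / 3) (hα2 : 2 * α₀ ≤ c2' d L) (hα₁ : 0 ≤ α₁)
    (hsmall : 11 * (d : ℝ) ^ 2 * α₀ + α₁ ≤ 1 / 6)
    (U₀ : (zdGF3 𝔸 L β len i).Cfg) (P : (zdGF3 𝔸 L β len i).Pert)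
    (hInA : (zdGF3 𝔸 L β len i).InA α₀ U₀) (hInAAx : (zdGF3 𝔸 L β len i).InAAx α₀ U₀ P)
    (h35 : ∀ j, j ≤ i.k → ∀ (z : Site d) (μ : Fin d), BondTouches (i.Λs i.k j) z μ →
      (∀ x, InBox (loK L j z) (bondHiK L j z μ) x → x ∈ i.Ω j) →
      ‖(avgIter L (mulCfg P.2.1 U₀.1) j z μ : 𝔸) - (avgIter L U₀.1 j z μ : 𝔸)‖ ≤ α₁) :
    (zdGF3 𝔸 L β len i).avgClose (11 * (d : ℝ) ^ 2 * α₀ + α₁) U₀ P := by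
  obtain ⟨hP1, h34, hAx⟩ := hInAAx
  intro j hj z μ hbox
  exact norm_avg_sub_le_allLevels_of135 hd hL i.k U₀.2 P.2.2 hα₀ hα3 hα2 hα₁ hsmall i.Ω i.hΩ (i.Λs i.k) i.htower h16
    hInA h34 (hAx i.k le_rfl) h35 hj z μ hbox

/-- **(1.65) AT THE MEMBER ON THE `Ω₀ = ℤᵈ` SUB-FAMILY: `zdGF3.avgClose166 (11d²α₀ + α₁)`** (its two clauses: the all-levels box-currency
closeness, and the level-`0` member `‖U′_b − 1‖ ≤ 11d²α₀ + α₁` on the bonds touching `Ω₀ = ℤᵈ`, i.e. on every bond) from (1.33), (1.34) and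
(1.35) ON THE LAYERS, for a member with `Ω 0 = univ` carrying (1.6) at every level. [cite: Balaban1985RegularSpaces, (1.65)–(1.66) p.87, (1.33)–(1.35) p.82, (1.6) p.77, p.77 («Ω_j = T_η»)] -/
theorem avgClose166_zdGF3_of135_univ (hd : 1 ≤ d) {L : ℕ} (hL : 2 ≤ L) {β : ℝ} {len : Site d → ℝ} (i : ZdIdx d L)
    (hi : i.Ω 0 = Set.univ)
    (h16 : ∀ ℓ, ℓ ≤ i.k → ∀ w : Site d, (∀ x, InBox (tlo L w ℓ) (thi L w ℓ) x → x ∈ i.Ω ℓ) →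
      ∃ j, ℓ ≤ j ∧ j ≤ i.k ∧ ∃ y ∈ i.Λs i.k j, Under L (j - ℓ) y w)
    {α₀ α₁ : ℝ} (hα₀ : 0 < α₀) (hα3 : C0 d * α₀ ≤ 1 / 3) (hα2 : 2 * α₀ ≤ c2' d L) (hα₁ : 0 ≤ α₁)
    (hsmall : 11 * (d : ℝ) ^ 2 * α₀ + α₁ ≤ 1 / 6)
    (U₀ : (zdGF3 𝔸 L β len i).Cfg) (P : (zdGF3 𝔸 L β len i).Pert)
    (hInA : (zdGF3 𝔸 L β len i).InA α₀ U₀) (hInAAx : (zdGF3 𝔸 L β len i).InAAx α₀ U₀ P)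
    (h35 : ∀ j, j ≤ i.k → ∀ (z : Site d) (μ : Fin d), BondTouches (i.Λs i.k j) z μ →
      (∀ x, InBox (loK L j z) (bondHiK L j z μ) x → x ∈ i.Ω j) →
      ‖(avgIter L (mulCfg P.2.1 U₀.1) j z μ : 𝔸) - (avgIter L U₀.1 j z μ : 𝔸)‖ ≤ α₁) :
    (zdGF3 𝔸 L β len i).avgClose166 (11 * (d : ℝ) ^ 2 * α₀ + α₁) U₀ P := by
  refine ⟨avgClose_zdGF3_of135 hd hL i h16 hα₀ hα3 hα2 hα₁ hsmall U₀ P hInA hInAAx h35, ?_⟩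
  obtain ⟨hP1, h34, hAx⟩ := hInAAx
  have hpart : ∀ x : Site d, ∃ j, j ≤ i.k ∧ ∃ y ∈ i.Λs i.k j, InBox (tlo L y j) (thi L y j) x := by
    intro x
    have hx : x ∈ i.Ω 0 := by rw [hi]; trivial
    exact i.hpart x hx
  intro b _
  exact norm_pert_sub_one_le_univ_of135 hd hL i.k U₀.2 P.2.2 hα₀ hα3 hα2 hα₁ hsmall i.Ω i.hΩ (i.Λs i.k) i.htower hpart
    hInA h34 (hAx i.k le_rfl) h35 b.1 b.2

/-- **(1.33)–(1.35) ⇒ (1.66) AT THE MEMBER, BOTH CURRENCIES AT ONCE** on the `Ω₀ = ℤᵈ` sub-family (the pair Theorem 4's hypothesis and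
Theorem 2's assembly read): `avgClose (11d²α₀ + α₁) U₀ P ∧ avgClose166 (11d²α₀ + α₁) U₀ P`.
[cite: Balaban1985RegularSpaces, (1.65)–(1.66) p.87, Thm 4 p.88 («Of course this theorem implies Theorem 2»)] -/
theorem avgClose_and_avgClose166_zdGF3_of135_univ (hd : 1 ≤ d) {L : ℕ} (hL : 2 ≤ L) {β : ℝ} {len : Site d → ℝ} (i : ZdIdx d L)
    (hi : i.Ω 0 = Set.univ)
    (h16 : ∀ ℓ, ℓ ≤ i.k → ∀ w : Site d, (∀ x, InBox (tlo L w ℓ) (thi L w ℓ) x → x ∈ i.Ω ℓ) →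
      ∃ j, ℓ ≤ j ∧ j ≤ i.k ∧ ∃ y ∈ i.Λs i.k j, Under L (j - ℓ) y w)
    {α₀ α₁ : ℝ} (hα₀ : 0 < α₀) (hα3 : C0 d * α₀ ≤ 1 / 3) (hα2 : 2 * α₀ ≤ c2' d L) (hα₁ : 0 ≤ α₁)
    (hsmall : 11 * (d : ℝ) ^ 2 * α₀ + α₁ ≤ 1 / 6)
    (U₀ : (zdGF3 𝔸 L β len i).Cfg) (P : (zdGF3 𝔸 L β len i).Pert)
    (hInA : (zdGF3 𝔸 L β len i).InA α₀ U₀) (hInAAx : (zdGF3 𝔸 L β len i).InAAx α₀ U₀ P)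
    (h35 : ∀ j, j ≤ i.k → ∀ (z : Site d) (μ : Fin d), BondTouches (i.Λs i.k j) z μ →
      (∀ x, InBox (loK L j z) (bondHiK L j z μ) x → x ∈ i.Ω j) →
      ‖(avgIter L (mulCfg P.2.1 U₀.1) j z μ : 𝔸) - (avgIter L U₀.1 j z μ : 𝔸)‖ ≤ α₁) :
    (zdGF3 𝔸 L β len i).avgClose (11 * (d : ℝ) ^ 2 * α₀ + α₁) U₀ P ∧
      (zdGF3 𝔸 L β len i).avgClose166 (11 * (d : ℝ) ^ 2 * α₀ + α₁) U₀ P :=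
  ⟨avgClose_zdGF3_of135 hd hL i h16 hα₀ hα3 hα2 hα₁ hsmall U₀ P hInA hInAAx h35,
    avgClose166_zdGF3_of135_univ hd hL i hi h16 hα₀ hα3 hα2 hα₁ hsmall U₀ P hInA hInAAx h35⟩

end Member

#print axioms avgClose166_zdGF3_of135_univ

end Literature.MathematicalPhysics.QuantumFieldTheory.Balaban1983to89.B8LeafModelZd3Ineq165

end
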